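import Summits.BirchSwinnertonDyer.BirchSwinnertonDyer.Theorems.UniversalToricDescentProPrimeToPVanishing
import Literature.NumberTheory.GaloisRepresentations.DualityLineTwo
import Mathlib.Topology.Algebra.ClopenNhdofOne
import HarnessLib

/-!
# Route UniversalToricDescent — `H¹(G, A) = 0` for a profinite `G = cl⟨N, τ⟩` with `N` pro-prime-to-`p`,
# acting on a divisible `p`-primary `A` with finite `A[p^k]` and FINITE `A^G`

Lead prover bsd-wall-utd-p1 g10 (`--supports stmt-BirchSwinnertonDyer-20399`; engine of the
Greenberg–Vatsal Prop. (2.4) local term `s_v` at an ADDITIVE place, memo GV24-LOCAL-TERM §3). The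
abstract form of "`H¹(I_v, E[p^∞]) = H¹(I_v/J_v, E[p^∞]^{J_v}) = (E[p^∞]^{J_v})_{τ} = 0` when
`V_p(E)^{I_v} = 0`" (Greenberg–Vatsal, proof of Prop. (2.4); `J_v ⊴ I_v` the prime-to-`p` part,
`I_v/J_v ≅ ℤ_p(1) = cl⟨τ⟩`):

Let `G` be a profinite group, `N ⊴ G` a closed normal subgroup which is pro-prime-to-`p` (every open
normal subgroup of `N` has index prime to `p`) and `τ ∈ G` such that `N` and `τ` topologically generate `G`
(at every open normal level `U`: `G = ⋃ₖ τᵏ N U`). Let `A` be a discrete `G`-module (continuous action)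
which is `p`-primary, `p`-divisible, with all `A[p^k]` finite, and with FINITE invariants `A^G`. Then

* `subsingleton_continuousCohomology_one_of_proPrimeToP_of_topGenerator` — **`H¹(G, A) = 0`**.

Proof. A continuous crossed homomorphism `φ` is a coboundary on `N` (`H¹(N, A) = 0`,
`UniversalToricDescentProPrimeToPVanishing`), so after a coboundary `φ|_N = 0` and `φ` takes values in
`C = A^N`. `C` is `p`-divisible (`H¹(N, A[p]) = 0` lifts `p`-th roots into `C`), `p`-primary with finite
`C[p^k]`, and `T = τ − 1 : C → C` has kernel `A^{cl⟨N,τ⟩} = A^G`, finite; hence `T` is onto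
(`surjective_of_finite_ker`: the cokernel of such a `T` is finite and divisible, so trivial). With
`τ y − y = φ(τ)`, `y ∈ C`, the cocycle `φ − ∂y` vanishes on `N` and at `τ`, hence on the open subgroup
they generate with any open normal `U` inside its zero set, i.e. everywhere.

THEOREMS ONLY; no definition, no named fact, no `sorry`. BSD is not advanced by this file.
References: [GreenbergVatsal2000] §2, proof of Prop. (2.4) (arXiv p. 22: "`I_ℓ` contains a unique
subgroup `J_ℓ` … `I_ℓ/J_ℓ ≅ ℤ_p(1)`"); [SerreLocalFields1979] Ch. XIII §1 Prop. 1 (`H¹(Ẑ, A) = A/(F−1)A`);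
[SerreGaloisCohomology1997] I §3.3 Prop. 14 Cor. 2 (`cd_p` of a pro-`p′` group is `0`).
-/

set_option autoImplicit false
-- `…BirchSwinnertonDyer.BirchSwinnertonDyer.Theorems…` is the problem's mandated namespace (D-0017).
set_option linter.dupNamespace false

noncomputable section

open scoped Classical

namespace Summit.BirchSwinnertonDyer.BirchSwinnertonDyer.Theorems.UniversalToricDescentTameQuotientVanishing

open Literature.NumberTheory.GaloisRepresentations ContinuousCohomology Topology Function
  Summit.BirchSwinnertonDyer.BirchSwinnertonDyer.Theorems.UniversalToricDescentProPrimeToP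

/-! ### §1 Algebra: an endomorphism with finite kernel of a divisible `p`-primary group is onto -/

section Algebra

variable {C : Type*} [AddCommGroup C] {p : ℕ}

/-- A FINITE `p`-divisible `p`-primary abelian group is trivial (multiplication by `p` is onto, hence
injective). [folklore] -/
theorem eq_zero_of_finite_of_divisible [Finite C] (hC : ∀ c : C, ∃ k : ℕ, p ^ k • c = 0)
    (hdiv : ∀ c : C, ∃ c' : C, p • c' = c) (c : C) : c = 0 := by
  have hsurj : Surjective (fun x : C ↦ p • x) := fun x ↦ hdiv x
  have hinj : Injective (fun x : C ↦ p • x) := Finite.injective_iff_surjective.mpr hsurj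
  obtain ⟨k, hk⟩ := hC c
  induction k generalizing c with
  | zero => simpa using hk
  | succ k ih =>
    apply ih c
    apply hinj
    show p • (p ^ k • c) = p • 0
    rw [smul_zero, ← mul_nsmul', ← pow_succ', hk]

/-- **An additive endomorphism `T` with finite kernel of a `p`-divisible `p`-primary abelian group `C`
with finite layers `C[p^k]` is surjective.** The cokernel `Q = C/T(C)` is `p`-divisible and `p`-primary;
every finite subset of `Q` lifts into one finite layer `C[p^j]`, on which
`[C[p^j] : T(C[p^j])] = #ker(T|C[p^j]) ≤ #ker T`, so `Q` is finite of order `≤ #ker T`, hence trivial.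
[folklore] -/
theorem surjective_of_finite_ker (T : C →+ C) (hC : ∀ c : C, ∃ k : ℕ, p ^ k • c = 0)
    (hdiv : ∀ c : C, ∃ c' : C, p • c' = c) (hfin : ∀ k : ℕ, Set.Finite {c : C | p ^ k • c = 0})
    (hker : Set.Finite {c : C | T c = 0}) : Surjective T := by
  -- the cokernel
  let R : AddSubgroup C := T.range
  let Q := C ⧸ R
  let π : C →+ Q := QuotientAddGroup.mk' R
  have hπ : Surjective π := QuotientAddGroup.mk'_surjective R
  -- the kernel as a finite type
  let K := {c : C // T c = 0}
  haveI : Finite K := hker.to_subtype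
  -- Step 1: every finite subset of `Q` has at most `#K` elements
  have step1 : ∀ s : Finset Q, s.card ≤ Nat.card K := by
    intro s
    choose f hf using hπ
    choose k hk using hC
    let j : ℕ := s.sup fun q ↦ k (f q)
    have hj : ∀ q ∈ s, p ^ j • f q = 0 := fun q hq ↦ by
      have hle : k (f q) ≤ j := Finset.le_sup (f := fun q ↦ k (f q)) hq
      rw [← Nat.sub_add_cancel hle, pow_add, mul_nsmul', hk, smul_zero]
    -- the finite layer `C[p^j]`
    let Cj : AddSubgroup C :=
      { carrier := {c | p ^ j • c = 0}
        zero_mem' := smul_zero _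
        add_mem' := fun {a b} ha hb ↦ by
          simp only [Set.mem_setOf_eq] at ha hb ⊢
          rw [smul_add, ha, hb, add_zero]
        neg_mem' := fun {a} ha ↦ by
          simp only [Set.mem_setOf_eq] at ha ⊢
          rw [smul_neg, ha, neg_zero] }
    haveI : Finite Cj := (hfin j).to_subtype
    have hTmem : ∀ c : Cj, T c ∈ Cj := fun c ↦ by
      show p ^ j • T c = 0
      rw [← map_nsmul, c.2, map_zero]
    let Tj : Cj →+ Cj :=
      { toFun := fun c ↦ ⟨T c, hTmem c⟩
        map_zero' := Subtype.ext (by simp)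
        map_add' := fun a b ↦ Subtype.ext (by simp) }
    let πj : Cj →+ Q := π.comp Cj.subtype
    haveI : Finite πj.range := Finite.of_surjective πj.rangeRestrict πj.rangeRestrict_surjective
    -- `s ⊆ πj.range`
    have hsub : ∀ q ∈ s, q ∈ πj.range := fun q hq ↦ ⟨⟨f q, hj q hq⟩, hf q⟩
    have h1 : s.card ≤ Nat.card πj.range := by
      rw [← Nat.card_eq_finsetCard]
      exact Nat.card_le_card_of_injective (fun x : {x // x ∈ s} ↦ (⟨x.1, hsub x.1 x.2⟩ : πj.range))
        fun a b h ↦ Subtype.ext (congrArg (fun y : πj.range ↦ (y : Q)) h)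
    -- `Tj.range ≤ πj.ker`
    have h2 : Tj.range ≤ πj.ker := by
      rintro _ ⟨y, rfl⟩
      rw [AddMonoidHom.mem_ker]
      show π (T y) = 0
      exact (QuotientAddGroup.eq_zero_iff _).mpr ⟨y, rfl⟩
    have h2' : Nat.card Tj.range ≤ Nat.card πj.ker := AddSubgroup.card_le_of_le h2
    -- first isomorphism theorem, twice
    have h3 : Nat.card πj.range * Nat.card πj.ker = Nat.card Cj := by
      rw [← Nat.card_congr (QuotientAddGroup.quotientKerEquivRange πj).toEquiv,
        ← AddSubgroup.card_eq_card_quotient_mul_card_addSubgroup]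
    have h4 : Nat.card Tj.range * Nat.card Tj.ker = Nat.card Cj := by
      rw [← Nat.card_congr (QuotientAddGroup.quotientKerEquivRange Tj).toEquiv,
        ← AddSubgroup.card_eq_card_quotient_mul_card_addSubgroup]
    have h5 : Nat.card πj.range ≤ Nat.card Tj.ker := by
      have hpos : 0 < Nat.card πj.ker := Nat.card_pos
      have : Nat.card πj.range * Nat.card πj.ker ≤ Nat.card Tj.ker * Nat.card πj.ker := by
        calc Nat.card πj.range * Nat.card πj.ker = Nat.card Tj.range * Nat.card Tj.ker := by
              rw [h3, h4]
          _ ≤ Nat.card πj.ker * Nat.card Tj.ker := Nat.mul_le_mul_right _ h2'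
          _ = Nat.card Tj.ker * Nat.card πj.ker := mul_comm _ _
      exact Nat.le_of_mul_le_mul_right this hpos
    -- `Tj.ker ↪ K`
    have h6 : Nat.card Tj.ker ≤ Nat.card K :=
      Nat.card_le_card_of_injective (fun x : Tj.ker ↦ (⟨((x : Cj) : C), by
          have hx : Tj x = 0 := (AddMonoidHom.mem_ker).mp x.2
          exact congrArg Subtype.val hx⟩ : K))
        fun a b h ↦ by
          have h' := congrArg (fun z : K ↦ (z : C)) h
          dsimp only at h'
          exact Subtype.ext (Subtype.ext h')
    exact h1.trans (h5.trans h6)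
  -- Step 2: `Q` is finite
  haveI : Finite Q := by
    by_contra h
    haveI : Infinite Q := not_finite_iff_infinite.mp h
    obtain ⟨s, hs⟩ := Infinite.exists_subset_card_eq Q (Nat.card K + 1)
    have := step1 s
    omega
  -- Step 3: `Q` is `p`-primary and `p`-divisible, hence trivial
  have hQ : ∀ q : Q, q = 0 := by
    refine eq_zero_of_finite_of_divisible (p := p) (fun q ↦ ?_) (fun q ↦ ?_)
    · obtain ⟨c, rfl⟩ := hπ q
      obtain ⟨k, hk⟩ := hC c
      exact ⟨k, by rw [← map_nsmul, hk, map_zero]⟩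
    · obtain ⟨c, rfl⟩ := hπ q
      obtain ⟨c', hc'⟩ := hdiv c
      exact ⟨π c', by rw [← map_nsmul, hc']⟩
  -- Step 4
  intro c
  obtain ⟨y, hy⟩ := (QuotientAddGroup.eq_zero_iff c).mp (hQ (π c))
  exact ⟨y, hy⟩

end Algebra

/-! ### §2 The vanishing theorem -/

variable {G : Type} [Group G] [TopologicalSpace G] [IsTopologicalGroup G] [CompactSpace G]
  [TotallyDisconnectedSpace G]
variable {M : Type} [AddCommGroup M] [TopologicalSpace M] [DiscreteTopology M]
variable (ρ : ContinuousRep G ℤ M) {p : ℕ}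

/-- **`H¹(G, A) = 0` for `G = cl⟨N, τ⟩`, `N ⊴ G` closed and pro-prime-to-`p`, `A` a discrete `p`-divisible
`p`-primary `G`-module with finite `A[p^k]` and FINITE `A^G`.** Hypotheses: `hM` (`p`-primary), `hdiv`
(`p`-divisible), `hfin` (finite layers), `hNc`/`hcopN` (`N` closed, every open normal subgroup of `N` of
index prime to `p`), `hgen` (`G = ⋃ₖ τᵏ N U` for every open normal `U`), `hfix` (`A^G` finite). This is the
mechanism of Greenberg–Vatsal's computation `H¹(I_ℓ, A) = (A^{J_ℓ})_{τ}(−1)`, in the case where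
`τ − 1` is invertible up to a finite kernel. [cite: GreenbergVatsal2000, §2, proof of Prop. (2.4) (arXiv p. 22)]
[cite: SerreLocalFields1979, Ch. XIII §1 Prop. 1] [cite: SerreGaloisCohomology1997, I §3.3 Prop. 14 Cor. 2] -/
theorem subsingleton_continuousCohomology_one_of_proPrimeToP_of_topGenerator
    (hM : ∀ m : M, ∃ k : ℕ, p ^ k • m = 0) (hdiv : ∀ m : M, ∃ m' : M, p • m' = m)
    (hfin : ∀ k : ℕ, Set.Finite {m : M | p ^ k • m = 0})
    (N : Subgroup G) [N.Normal] (hNc : IsClosed (N : Set G))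
    (hcopN : ∀ U : Subgroup N, U.Normal → IsOpen (U : Set N) → U.index.Coprime p)
    (τ : G) (hgen : ∀ U : Subgroup G, U.Normal → IsOpen (U : Set G) →
      ∀ σ : G, ∃ k : ℕ, ∃ n ∈ N, ∃ u ∈ U, σ = τ ^ k * n * u)
    (hfix : Set.Finite {m : M | ∀ g : G, ρ g m = m}) :
    Subsingleton (continuousCohomology 1 ρ.toTopRep) := by
  -- topology on `N`
  haveI : CompactSpace N := isCompact_iff_compactSpace.mp hNc.isCompact
  let ρN : ContinuousRep N ℤ M := ρ.restrict (subgroupIncl N)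
  -- `H¹(N, A) = 0` and `H¹(N, A[p]) = 0`
  haveI hN1 : Subsingleton (continuousCohomology 1 ρN.toTopRep) :=
    subsingleton_continuousCohomology_one_of_coprime_index ρN hcopN hM
  have hMp : ∀ m : Submodule.torsionBy ℤ M (p : ℤ), ∃ k : ℕ, p ^ k • m = 0 := fun m ↦
    ⟨1, Subtype.ext (by
      rw [pow_one, AddSubmonoidClass.coe_nsmul, ZeroMemClass.coe_zero]
      exact (ContinuousRep.mem_torsionBy_nsmul_iff p).mp m.2)⟩
  haveI hN1p : Subsingleton (continuousCohomology 1 (ρN.torsionRep p).toTopRep) :=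
    subsingleton_continuousCohomology_one_of_coprime_index (ρN.torsionRep p) hcopN hMp
  -- an open subgroup containing `N` and `τ` is everything
  have hall : ∀ Z : Subgroup G, IsOpen (Z : Set G) → N ≤ Z → τ ∈ Z → ∀ σ : G, σ ∈ Z := by
    intro Z hZ hNZ hτZ σ
    obtain ⟨U, hU⟩ := ProfiniteGrp.exist_openNormalSubgroup_sub_open_nhds_of_one hZ Z.one_mem
    obtain ⟨k, n, hn, u, hu, rfl⟩ := hgen U inferInstance U.isOpen' σ
    exact Z.mul_mem (Z.mul_mem (Z.pow_mem hτZ k) (hNZ hn)) (hU hu)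
  have hconjN : ∀ (g : G) (n : G), n ∈ N → g⁻¹ * n * g ∈ N := fun g n hn ↦ by
    have := ‹N.Normal›.conj_mem n hn g⁻¹
    rwa [inv_inv] at this
  -- the invariants `C = A^N` as an additive subgroup, stable under `τ`
  let Cs : AddSubgroup M :=
    { carrier := {m | ∀ n ∈ N, ρ n m = m}
      zero_mem' := fun n _ ↦ map_zero _
      add_mem' := fun {a b} ha hb n hn ↦ by rw [map_add, ha n hn, hb n hn]
      neg_mem' := fun {a} ha n hn ↦ by rw [map_neg, ha n hn] }
  have hτC : ∀ m ∈ Cs, ρ τ m ∈ Cs := fun m hm n hn ↦ by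
    rw [← Module.End.mul_apply, ← map_mul, show n * τ = τ * (τ⁻¹ * n * τ) by group, map_mul,
      Module.End.mul_apply, hm _ (hconjN τ n hn)]
  -- `C` is `p`-divisible: lift a `p`-th root through `H¹(N, A[p]) = 0`
  have hCdiv : ∀ c : Cs, ∃ c' : Cs, p • c' = c := by
    intro c
    obtain ⟨b, hb⟩ := hdiv (c : M)
    have hval : ∀ n : N, ρ (n : G) b - b ∈ Submodule.torsionBy ℤ M (p : ℤ) := fun n ↦ by
      rw [ContinuousRep.mem_torsionBy_nsmul_iff, smul_sub, ← map_nsmul, hb, c.2 _ n.2, sub_self]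
    let ψ : contOneCocycles (ρN.torsionRep p).toTopRep :=
      ⟨⟨fun n ↦ ⟨ρ (n : G) b - b, hval n⟩,
        (((ρ.continuous_apply_left b).comp continuous_subtype_val).sub continuous_const).subtype_mk _⟩,
        fun n n' ↦ Subtype.ext (by
          show ρ ((n * n' : N) : G) b - b = (ρ (n : G) b - b) + ρ (n : G) (ρ (n' : G) b - b)
          rw [Subgroup.coe_mul, map_mul, Module.End.mul_apply, map_sub]
          abel)⟩
    obtain ⟨v, hv⟩ := (oneCocycleClass_eq_zero_iff _ ψ).mp (Subsingleton.elim _ _)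
    have hv' : ∀ n : N, ρ (n : G) b - b = ρ (n : G) (v : M) - v := fun n ↦
      congrArg Subtype.val (hv n)
    refine ⟨⟨b - v, fun n hn ↦ ?_⟩, Subtype.ext ?_⟩
    · rw [map_sub]
      exact (sub_eq_sub_iff_sub_eq_sub.mp (hv' ⟨n, hn⟩))
    · show p • (b - (v : M)) = c
      rw [smul_sub, hb, (ContinuousRep.mem_torsionBy_nsmul_iff p).mp v.2, sub_zero]
  -- the `T = τ − 1` on `C` is onto
  let T : Cs →+ Cs :=
    { toFun := fun c ↦ ⟨ρ τ c - c, Cs.sub_mem (hτC c c.2) c.2⟩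
      map_zero' := Subtype.ext (by simp)
      map_add' := fun a b ↦ Subtype.ext (by
        simp only [AddSubgroup.coe_add, map_add, AddMemClass.mk_add_mk]
        abel) }
  have hTsurj : Surjective T := by
    refine surjective_of_finite_ker (p := p) T (fun c ↦ ?_) hCdiv (fun k ↦ ?_) ?_
    · obtain ⟨k, hk⟩ := hM (c : M)
      exact ⟨k, Subtype.ext (by rw [AddSubmonoidClass.coe_nsmul, hk, ZeroMemClass.coe_zero])⟩
    · exact ((hfin k).preimage Subtype.val_injective.injOn).subset fun c hc ↦ by
        show p ^ k • (c : M) = 0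
        rw [← AddSubmonoidClass.coe_nsmul, (hc : p ^ k • c = 0), ZeroMemClass.coe_zero]
    · refine (hfix.preimage Subtype.val_injective.injOn).subset fun c hc ↦ ?_
      have hc' : ρ τ (c : M) = c := by
        have := congrArg Subtype.val (hc : T c = 0)
        exact sub_eq_zero.mp this
      -- the stabiliser of `c` is an open subgroup containing `N` and `τ`
      let Z : Subgroup G :=
        { carrier := {g | ρ g (c : M) = c}
          one_mem' := by simp
          mul_mem' := fun {g h} hg hh ↦ by
            simp only [Set.mem_setOf_eq] at hg hh ⊢
            rw [map_mul, Module.End.mul_apply, hh, hg]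
          inv_mem' := fun {g} hg ↦ by
            simp only [Set.mem_setOf_eq] at hg ⊢
            have h := congrArg (ρ g⁻¹) hg
            rw [← Module.End.mul_apply, ← map_mul, inv_mul_cancel, map_one, Module.End.one_apply] at h
            exact h.symm }
      have hZ : IsOpen (Z : Set G) :=
        (isOpen_discrete ({(c : M)} : Set M)).preimage (ρ.continuous_apply_left (c : M))
      show ∀ g : G, ρ g (c : M) = c
      exact fun g ↦ hall Z hZ (fun n hn ↦ c.2 n hn) hc' g
  -- now the cocycles
  refine ⟨fun x y ↦ ?_⟩
  suffices h : ∀ x : continuousCohomology 1 ρ.toTopRep, x = 0 by rw [h x, h y]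
  intro x
  obtain ⟨φ, rfl⟩ := oneCocycleClass_surjective _ x
  rw [oneCocycleClass_eq_zero_iff]
  have hf : ∀ g h : G, φ.1 (g * h) = φ.1 g + ρ g (φ.1 h) := fun g h ↦ φ.2 g h
  have hf1 : φ.1 1 = 0 := contOneCocycles.apply_one φ
  -- Step 1: `φ|_N` is a coboundary `∂a`
  let φN : contOneCocycles ρN.toTopRep :=
    ⟨φ.1.comp ⟨((↑) : N → G), continuous_subtype_val⟩, fun n n' ↦ by
      show φ.1 ((n : G) * n') = φ.1 n + ρ (n : G) (φ.1 n')
      exact hf n n'⟩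
  obtain ⟨a, ha⟩ := (oneCocycleClass_eq_zero_iff _ φN).mp (Subsingleton.elim _ _)
  have ha' : ∀ n ∈ N, φ.1 n = ρ n a - a := fun n hn ↦ ha ⟨n, hn⟩
  -- `f₁ = φ − ∂a` vanishes on `N` and takes values in `C`
  let f₁ : G → M := fun g ↦ φ.1 g - (ρ g a - a)
  have hf₁ : ∀ g h : G, f₁ (g * h) = f₁ g + ρ g (f₁ h) := fun g h ↦ by
    simp only [f₁, hf, map_sub, map_mul, Module.End.mul_apply]
    abel
  have hf₁N : ∀ n ∈ N, f₁ n = 0 := fun n hn ↦ by simp only [f₁, ha' n hn, sub_self]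
  have hf₁C : ∀ g : G, f₁ g ∈ Cs := fun g n hn ↦ by
    have h1 : f₁ (n * g) = ρ n (f₁ g) := by rw [hf₁, hf₁N n hn, zero_add]
    have h2 : f₁ (n * g) = f₁ g := by
      rw [show n * g = g * (g⁻¹ * n * g) by group, hf₁, hf₁N _ (hconjN g n hn), map_zero, add_zero]
    rw [← h1, h2]
  -- Step 2: solve `τ y − y = f₁ τ` in `C`
  obtain ⟨y, hy⟩ := hTsurj ⟨f₁ τ, hf₁C τ⟩
  have hy' : ρ τ (y : M) - y = f₁ τ := congrArg Subtype.val hy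
  -- `f₂ = f₁ − ∂y` vanishes on `N` and at `τ`, hence everywhere
  let f₂ : G → M := fun g ↦ f₁ g - (ρ g y - y)
  have hf₂ : ∀ g h : G, f₂ (g * h) = f₂ g + ρ g (f₂ h) := fun g h ↦ by
    simp only [f₂, hf₁, map_sub, map_mul, Module.End.mul_apply]
    abel
  have hf₂N : ∀ n ∈ N, f₂ n = 0 := fun n hn ↦ by
    simp only [f₂, hf₁N n hn, y.2 n hn, sub_self]
  have hf₂τ : f₂ τ = 0 := by simp only [f₂, hy', sub_self]
  have hf₂one : f₂ 1 = 0 := by simp only [f₂, f₁, hf1, map_one, Module.End.one_apply, sub_self]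
  have hf₂cont : Continuous f₂ :=
    (φ.1.continuous.sub ((ρ.continuous_apply_left a).sub continuous_const)).sub
      ((ρ.continuous_apply_left (y : M)).sub continuous_const)
  let Z : Subgroup G :=
    { carrier := {g | f₂ g = 0}
      one_mem' := hf₂one
      mul_mem' := fun {g h} hg hh ↦ by
        simp only [Set.mem_setOf_eq] at hg hh ⊢
        rw [hf₂, hg, hh, map_zero, add_zero]
      inv_mem' := fun {g} hg ↦ by
        simp only [Set.mem_setOf_eq] at hg ⊢
        have h := hf₂ g⁻¹ g
        rw [inv_mul_cancel, hf₂one, hg, map_zero, add_zero] at h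
        exact h.symm }
  have hZ : IsOpen (Z : Set G) := (isOpen_discrete ({(0 : M)} : Set M)).preimage hf₂cont
  have hzero : ∀ g : G, f₂ g = 0 := fun g ↦ hall Z hZ (fun n hn ↦ hf₂N n hn) hf₂τ g
  refine ⟨a + y, fun g ↦ ?_⟩
  show φ.1 g = ρ g (a + y) - (a + y)
  have := hzero g
  simp only [f₂, f₁, sub_eq_zero] at this
  rw [map_add]
  rw [sub_eq_iff_eq_add] at this
  rw [this]
  abel

end Summit.BirchSwinnertonDyer.BirchSwinnertonDyer.Theorems.UniversalToricDescentTameQuotientVanishing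

end
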